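import Summits.HodgeConjecture.HodgeConjecture.Theorems.CyclicUnitaryPowersCurvesOfLargeMonodromyHodgeOffCountable
import Literature.AlgebraicGeometry.HodgeTheory.CyclicCoverLinearPencilLoops
import Literature.AlgebraicGeometry.FundamentalGroup.HypersurfaceComplementPencilDiscriminantShift
import HarnessLib

/-!
# Route CyclicUnitaryPowers — on every pencil `x₃^p = f₀ + u·g` of a ZARISKI-OPEN set of pencils, the Hodge
# conjecture holds on all powers of ALL BUT COUNTABLY MANY members (unconditional; programme ZARISKI)

Support file for `stmt-HodgeConjecture-19544` (`--supports`; nothing here closes an item). Prover seat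
`hodge-nonav-prover-Ax` (g14, cell hodge-nonav). The large-monodromy hypothesis (HL) of the curve theorem
`hodgeConjectureFor_powers_offCountable_of_curve` (g13, p681839) is DISCHARGED for the linear pencils
`ι : P ⟶ S`, `u ↦ [x₃^p − (f₀ + u g)]` (`LinearPencil.pencilMap`), whenever the pointed line `(f₀, g)` of ternary
`p`-forms satisfies `pencilDiscr D (f₀, g) ≠ 0` for an irreducible equation `D` of the discriminant of plane curves
of degree `p` — an explicit, non-empty (`pencilDiscr_ne_zero`), Zariski-open condition on the pair `(f₀, g)`:

* ZARISKI'S THEOREM (tree theorem `HypersurfaceComplementZariskiPencils.range_lineInclHom_eq_top_of_pencilDiscr`,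
  Dimca Ch. 4 Prop. (3.1)): `π₁` of the punctured line surjects onto `π₁(ℂ^{N+1} ∖ Δ̃) = π₁(S(ℂ))`, at every
  point of the pencil (`eval_pencilDiscr_ne_zero_of_shift`; chart bookkeeping `LinearPencil.exists_loop_lift_pencilMap`);
* hence the whole monodromy group `Γ_{ι c}` of the Carlson–Toledo family consists of (conjugates of)
  monodromies of the pencil (`MonodromyGroupBaseChange.exists_finiteIndex_conj_mem_ratMonodromyGroup_familyPullback`)
  — hypothesis (HL) with `Γ₀ = Γ_{ι c}`;
* the curve theorem then gives a COUNTABLE exceptional set on the pencil.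

MAIN STATEMENTS: `hodgeConjectureFor_powers_offCountable_of_pencil` (for a given discriminant equation `D` and a
pair with `pencilDiscr D (f₀, g) ≠ 0`), **`exists_polynomial_pencils_hodge_offCountable`** (`∃ Q ≠ 0` on pairs of
coefficient vectors: `Q(f₀, g) ≠ 0 ⇒` HC on all powers of `x₃^p = f₀ + u g` for all but countably many `u`), and
the same for homogeneous ternary forms (`exists_polynomial_pencils_hodge_offCountable_forms`).

HONEST FRAMING: unconditional (no named fact; axioms standard) but NOT the item: the exceptional set on each
pencil is countable and unspecified, and pencils form a proper (if Zariski-dense) family of one-parameter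
sub-families; items 19544 ∕ 19543 stay OPEN (CDK floor); rung F-H1 not moved; nothing here says HC ∕ HC_CM ∕
HC_AV is proved.

## References
* [Dimca1992] A. Dimca, *Singularities and Topology of Hypersurfaces* (1992), Ch. 4 §3 Prop. (3.1).
* [Zariski1937] O. Zariski, Ann. of Math. 38 (1937) (the theorem on `π₁` of generic line sections).
* [Deligne1972WeilK3] P. Deligne, Invent. Math. 15 (1972), Prop. 7.5.
* [CarlsonToledo1999] J. A. Carlson, D. Toledo, Duke Math. J. 97 (1999), §2, §7 Theorem 7.1.
* [VoisinHodgeII2003] C. Voisin, *Hodge Theory and Complex Algebraic Geometry II*, §3.2.2 Thm. 3.22, §6.2.1.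
-/

noncomputable section

set_option linter.dupNamespace false

namespace Summit.HodgeConjecture.HodgeConjecture.Theorems.CyclicUnitaryPowersGenericCyclicSurfacePowersHodge

open scoped TensorProduct Topology
open CategoryTheory CategoryTheory.Limits AlgebraicGeometry Set
open _root_.Topology _root_.Filter
open Literature.AlgebraicGeometry.Motives Literature.AlgebraicGeometry.HodgeTheory
open Literature.AlgebraicGeometry.HodgeTheory.BettiUniverse
open Literature.AlgebraicGeometry.Motives.UniversalHypersurface Literature.AlgebraicGeometry.HodgeTheory.UniversalHypersurface
open Literature.AlgebraicGeometry.HodgeTheory.LinearPencil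
open Literature.AlgebraicGeometry.FundamentalGroup
open Literature.AlgebraicGeometry.Motives.SmoothHypersurface (IsNonsingularForm)

/-- **HC on all powers of all but countably many members of a transversal pencil of `p`-cyclic surfaces.**
`p ≥ 7` prime; `D` an equation of the discriminant of the cyclic family (`D(b) = 0 ↔ x₃^p − f_b` singular),
irreducible; `(f₀, g)` a pointed line of ternary coefficient vectors with `pencilDiscr D (f₀, g) ≠ 0`. Then there is
a COUNTABLE `C ⊆ ℂ` such that for every `u ∉ C`, every smooth projective `X ⊂ ℙ³` cut out by
`x₃^p − Σ_e ((f₀)_e + u g_e) x^e` and every self fibre power `Y = X^{k+1}` satisfy `HodgeConjectureFor (2(k+1)) Y`.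
Unconditional. [cite: Dimca1992, Ch. 4 §3 Prop. (3.1)] [cite: Deligne1972WeilK3, Prop. 7.5]
[cite: CarlsonToledo1999, §7 Theorem 7.1] [cite: VoisinHodgeII2003, §3.2.2 Thm. 3.22 and §6.2.1] -/
theorem hodgeConjectureFor_powers_offCountable_of_pencil {p : ℕ} (hp : p.Prime) (h7 : 7 ≤ p)
    {D : MvPolynomial (TernaryIndex p) ℂ} (hDirr : Irreducible D)
    (hD : ∀ b : TernaryIndex p → ℂ, MvPolynomial.eval b D = 0 ↔
      ¬ IsNonsingularForm ℂ (cyclicCoverForm p (∑ e : TernaryIndex p, MvPolynomial.monomial e.1 (b e))))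
    {f₀ g : TernaryIndex p → ℂ} (hQ : MvPolynomial.eval (Sum.elim f₀ g) (pencilDiscr D) ≠ 0) :
    ∃ C : Set ℂ, C.Countable ∧ ∀ u : ℂ, u ∉ C →
      ∀ ⦃X : SchemeOver ℂ⦄, IsSmoothProjective 2 X →
        IsHypersurfaceCutOutBy 3 (MvPolynomial.X (Fin.last 3) ^ p - MvPolynomial.rename Fin.castSucc
          (∑ e : TernaryIndex p, MvPolynomial.monomial e.1 (f₀ e + u * g e))) X →
        ∀ ⦃k : ℕ⦄ ⦃Y : SchemeOver ℂ⦄, (∃ π : Fin (k + 1) → (Y ⟶ X), Nonempty (IsLimit (Fan.mk Y π))) →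
          HodgeConjectureFor (2 * (k + 1)) Y := by
  classical
  haveI : NeZero p := ⟨hp.ne_zero⟩
  have hg : g ≠ 0 := ne_zero_of_pencilDiscr_of_irreducible hDirr hQ
  have hf₀ : MvPolynomial.eval f₀ D ≠ 0 := eval_ne_zero_of_pencilDiscr hQ
  have hf₀U : f₀ ∈ affineHypersurfaceComplement ![D] := mem_affineHypersurfaceComplement_of_pencilDiscr hQ
  -- ### the pencil `ι : P ⟶ S`
  let φ' := pencilCompSpz p f₀ g
  let ι := pencilMap p f₀ g
  have hPq : IsQuasiProjectiveOver (pencilBase p f₀ g) := isQuasiProjectiveOver_baseSpz 2 p φ'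
  haveI : SmoothOfRelativeDimension 1 (pencilBase p f₀ g).hom := by
    have h := smoothOfRelativeDimension_baseSpz_hom ℂ 2 p φ'
    rwa [Nat.card_eq_fintype_card, Fintype.card_fin] at h
  -- a point: `u = 0` (the form `x₃^p − f₀` is nonsingular)
  have hns0 : IsNonsingularForm ℂ (cyclicCoverForm p (∑ e : TernaryIndex p, MvPolynomial.monomial e.1 (f₀ e + 0 * g e))) := by
    by_contra hc
    refine hf₀ ?_
    have := (hD _).2 hc
    simpa using this
  obtain ⟨c₁, -⟩ := exists_pencilCoord_eq p f₀ g hns0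
  haveI : IrreducibleSpace (pencilBase p f₀ g).left := irreducibleSpace_baseSpz_left ℂ 2 p φ' ⟨c₁.pt⟩
  -- ### (HL) for the pencil: Zariski at every point
  have hU := cyclicCoverFamily_locallyTrivial p
  have hf' := (isSmoothProjectiveFamily_cyclicCoverFamily p).familyPullback_snd ι
  have hU' := isCohomologicallyLocallyTrivialOn_univ_of_isQuasiProjectiveOver
    (familyPullback.snd (cyclicCoverFamily p) ι) hf' hPq inferInstance
  have hQc : ∀ c : ComplexPoints (pencilBase p f₀ g),
      MvPolynomial.eval (Sum.elim (f₀ + pencilCoord p f₀ g c • g) g) (pencilDiscr D) ≠ 0 := by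
    intro c
    refine eval_pencilDiscr_ne_zero_of_shift hQ _ fun h0 => ?_
    have hns := isNonsingularForm_pencilCoord p f₀ g c
    refine (hD _).1 ?_ hns
    have heq : (f₀ + pencilCoord p f₀ g c • g) = fun e => f₀ e + pencilCoord p f₀ g c * g e := by
      funext e; simp [Pi.add_apply, Pi.smul_apply, smul_eq_mul]
    rwa [heq] at h0
  have HL := fun c : ComplexPoints (pencilBase p f₀ g) =>
    exists_finiteIndex_conj_mem_ratMonodromyGroup_familyPullback (cyclicCoverFamily p) ι 2 hU hU' c
      (fun γ => exists_loop_lift_pencilMap hD hg c (hQc c) γ)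
  -- ### the curve theorem
  obtain ⟨C, hCc, hC⟩ := hodgeConjectureFor_powers_offCountable_of_curve hp h7 hPq ι HL
  -- ### the countable exceptional set of parameters
  refine ⟨pencilCoord p f₀ g '' C ∪ {u | MvPolynomial.eval (fun e => f₀ e + u * g e) D = 0},
    (hCc.image _).union ?_, fun u hu X hX hcut k Y hY => ?_⟩
  · -- the singular parameters are finitely many (roots of the non-zero restriction `D(f₀ + u g)`)
    refine ((lineRoots_finite hf₀U g).subset fun u hu => ?_).countable
    refine ⟨0, ?_⟩
    have heq : (f₀ + u • g) = fun e => f₀ e + u * g e := by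
      funext e; simp [Pi.add_apply, Pi.smul_apply, smul_eq_mul]
    change MvPolynomial.eval (f₀ + u • g) (![D] 0) = 0
    rw [heq]; exact hu
  · rw [mem_union, not_or] at hu
    obtain ⟨hu1, hu2⟩ := hu
    have hns : IsNonsingularForm ℂ (cyclicCoverForm p (∑ e : TernaryIndex p, MvPolynomial.monomial e.1 (f₀ e + u * g e))) := by
      by_contra hc; exact hu2 ((hD _).2 hc)
    obtain ⟨c, hcu⟩ := exists_pencilCoord_eq p f₀ g hns
    have hcC : c ∉ C := fun h => hu1 ⟨c, h, hcu⟩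
    have hpoly : (∑ e : TernaryIndex p, MvPolynomial.monomial e.1 ((branchForm p (AlgPoints.map ι c)).coeff e.1)) =
        ∑ e : TernaryIndex p, MvPolynomial.monomial e.1 (f₀ e + u * g e) :=
      Finset.sum_congr rfl fun e _ => by rw [coeff_branchForm_map_pencilMap, hcu]
    have hcut' := hcut
    rw [← hpoly] at hcut'
    exact hC c hcC hX hcut' hY

/-- **There is a non-zero polynomial `Q` on pairs of ternary coefficient vectors such that every pencil
`x₃^p = f₀ + u g` with `Q(f₀, g) ≠ 0` carries only countably many members whose powers might fail the Hodge
conjecture** (`p ≥ 7` prime): for `Q(f₀, g) ≠ 0` there is a countable `C ⊆ ℂ` with HC on all self-powers of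
every smooth `X ⊂ ℙ³` cut out by `x₃^p − Σ_e ((f₀)_e + u g_e) x^e`, `u ∉ C`.  `Q = pencilDiscr D` for an
irreducible discriminant equation `D` (non-zero: `pencilDiscr_ne_zero`).  Unconditional — the algebraic
"very general member of a general pencil"; NOT the item `VeryGeneralDeckCommutatorsInHg` (CDK floor).
[cite: Dimca1992, Ch. 4 §3 Prop. (3.1)] [cite: Deligne1972WeilK3, Prop. 7.5] [cite: CarlsonToledo1999, §7 Theorem 7.1]
[cite: VoisinHodgeII2003, §3.2.2 Thm. 3.22 and §6.2.1] -/
theorem exists_polynomial_pencils_hodge_offCountable {p : ℕ} (hp : p.Prime) (h7 : 7 ≤ p) :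
    ∃ Q : MvPolynomial (TernaryIndex p ⊕ TernaryIndex p) ℂ, Q ≠ 0 ∧
      ∀ f₀ g : TernaryIndex p → ℂ, MvPolynomial.eval (Sum.elim f₀ g) Q ≠ 0 →
        ∃ C : Set ℂ, C.Countable ∧ ∀ u : ℂ, u ∉ C →
          ∀ ⦃X : SchemeOver ℂ⦄, IsSmoothProjective 2 X →
            IsHypersurfaceCutOutBy 3 (MvPolynomial.X (Fin.last 3) ^ p - MvPolynomial.rename Fin.castSucc
              (∑ e : TernaryIndex p, MvPolynomial.monomial e.1 (f₀ e + u * g e))) X →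
            ∀ ⦃k : ℕ⦄ ⦃Y : SchemeOver ℂ⦄, (∃ π : Fin (k + 1) → (Y ⟶ X), Nonempty (IsLimit (Fan.mk Y π))) →
              HodgeConjectureFor (2 * (k + 1)) Y := by
  classical
  obtain ⟨D, hDirr, hD⟩ := exists_irreducible_discriminantEquation (p := p) (by omega)
  exact ⟨pencilDiscr D, pencilDiscr_ne_zero hDirr, fun f₀ g hQ =>
    hodgeConjectureFor_powers_offCountable_of_pencil hp h7 hDirr hD hQ⟩

/-- The same for homogeneous ternary forms `f₀`, `g` of degree `p` (the language of the route's items): the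
condition is `Q((coeff_e f₀)_e, (coeff_e g)_e) ≠ 0`, the members are `x₃^p = f₀ + u·g`.
[cite: Dimca1992, Ch. 4 §3 Prop. (3.1)] [cite: CarlsonToledo1999, §7 Theorem 7.1] [cite: VoisinHodgeII2003, §3.2.2 Thm. 3.22] -/
theorem exists_polynomial_pencils_hodge_offCountable_forms {p : ℕ} (hp : p.Prime) (h7 : 7 ≤ p) :
    ∃ Q : MvPolynomial (TernaryIndex p ⊕ TernaryIndex p) ℂ, Q ≠ 0 ∧
      ∀ f₀ g : MvPolynomial (Fin 3) ℂ, f₀.IsHomogeneous p → g.IsHomogeneous p →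
        MvPolynomial.eval (Sum.elim (fun e : TernaryIndex p => f₀.coeff e.1) (fun e : TernaryIndex p => g.coeff e.1)) Q ≠ 0 →
        ∃ C : Set ℂ, C.Countable ∧ ∀ u : ℂ, u ∉ C →
          ∀ ⦃X : SchemeOver ℂ⦄, IsSmoothProjective 2 X →
            IsHypersurfaceCutOutBy 3 (MvPolynomial.X (Fin.last 3) ^ p -
              MvPolynomial.rename Fin.castSucc (f₀ + MvPolynomial.C u * g)) X →
            ∀ ⦃k : ℕ⦄ ⦃Y : SchemeOver ℂ⦄, (∃ π : Fin (k + 1) → (Y ⟶ X), Nonempty (IsLimit (Fan.mk Y π))) →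
              HodgeConjectureFor (2 * (k + 1)) Y := by
  classical
  obtain ⟨Q, hQ0, hQ⟩ := exists_polynomial_pencils_hodge_offCountable hp h7
  refine ⟨Q, hQ0, fun f₀ g hf₀ hg hQfg => ?_⟩
  obtain ⟨C, hCc, hC⟩ := hQ _ _ hQfg
  refine ⟨C, hCc, fun u hu X hX hcut k Y hY => hC u hu hX ?_ hY⟩
  -- `Σ_e (coeff_e f₀ + u coeff_e g) x^e = f₀ + u g` for homogeneous `f₀, g`
  have hhom : (f₀ + MvPolynomial.C u * g).IsHomogeneous p := by
    have h1 : (MvPolynomial.C u * g).IsHomogeneous (0 + p) := (MvPolynomial.isHomogeneous_C _ u).mul hg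
    rw [zero_add] at h1
    exact hf₀.add h1
  have heq : (∑ e : TernaryIndex p, MvPolynomial.monomial e.1 (f₀.coeff e.1 + u * g.coeff e.1)) =
      f₀ + MvPolynomial.C u * g := by
    have h := formOfCoeffs_coeff (n := 1) (d := p) (f₀ + MvPolynomial.C u * g) hhom
    refine Eq.trans (Finset.sum_congr rfl fun e _ => ?_) h
    simp only [MvPolynomial.coeff_add, MvPolynomial.coeff_C_mul]
  rw [heq]
  exact hcut

/-- **Reading (a″) of rung F-H1 — the very general member of a general pencil.**  For every prime `p ≥ 7`
there is a non-zero polynomial `Q` on pairs of coefficient vectors of ternary `p`-forms such that for all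
homogeneous `f₀, g` of degree `p` with `Q((coeff f₀), (coeff g)) ≠ 0`, all but COUNTABLY many members
`x₃^p = f₀ + u·g` of the pencil have the Hodge conjecture on all their self-powers (same statement as
`exists_polynomial_pencils_hodge_offCountable_forms`, in the shape of `cyclicSurfacePowersHodge_offMeagre` ∕ `_ae`
for the route header). Unconditional; NOT items 19544 ∕ 19543 (CDK floor); HC not proved.
[cite: Dimca1992, Ch. 4 §3 Prop. (3.1)] [cite: CarlsonToledo1999, §7 Theorem 7.1] [cite: VoisinHodgeII2003, §3.2.2 Thm. 3.22 and §6.2.1] -/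
theorem cyclicSurfacePowersHodge_generalPencil :
    ∀ ⦃p : ℕ⦄, p.Prime → 7 ≤ p →
      ∃ Q : MvPolynomial ({d : Fin 3 →₀ ℕ // d.degree = p} ⊕ {d : Fin 3 →₀ ℕ // d.degree = p}) ℂ, Q ≠ 0 ∧
        ∀ f₀ g : MvPolynomial (Fin 3) ℂ, f₀.IsHomogeneous p → g.IsHomogeneous p →
          MvPolynomial.eval (Sum.elim (fun d : {d : Fin 3 →₀ ℕ // d.degree = p} => f₀.coeff d.1)
            (fun d : {d : Fin 3 →₀ ℕ // d.degree = p} => g.coeff d.1)) Q ≠ 0 →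
          ∃ C : Set ℂ, C.Countable ∧ ∀ u : ℂ, u ∉ C →
            ∀ ⦃X : SchemeOver ℂ⦄, IsSmoothProjective 2 X →
              IsHypersurfaceCutOutBy 3 (MvPolynomial.X (Fin.last 3) ^ p -
                MvPolynomial.rename Fin.castSucc (f₀ + MvPolynomial.C u * g)) X →
              ∀ ⦃k : ℕ⦄ ⦃Y : SchemeOver ℂ⦄, (∃ π : Fin (k + 1) → (Y ⟶ X), Nonempty (IsLimit (Fan.mk Y π))) →
                HodgeConjectureFor (2 * (k + 1)) Y :=
  fun _ hp h7 => exists_polynomial_pencils_hodge_offCountable_forms hp h7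

end Summit.HodgeConjecture.HodgeConjecture.Theorems.CyclicUnitaryPowersGenericCyclicSurfacePowersHodge

end
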